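import Literature.NumberTheory.EllipticCurves.BinaryQuarticStabilizer
import HarnessLib

/-!
# First-order calculus of the invariants `I`, `J`, `Δ` of binary quartic forms, and the two deep
# strata of the discriminant locus (triple root, square of a quadratic) on which `dΔ` vanishes

`Proofs` companion (theorems only: no definitions, no named facts) of `BinaryQuarticForms.lean`
(`I`, `J`, `Δ`, `27Δ = 4I³ − J²`) and `BinaryQuarticStabilizer.lean` (coefficientwise addition).

Source and role. M. Bhargava, A. Shankar, *Binary quartic forms having bounded invariants, and the
boundedness of the average rank of elliptic curves*, Ann. of Math. (2) 181 (2015) 191–242. The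
`p`-adic estimates of §2.6–2.7 and §3 of the published version (= `arXiv:1006.1002v3`; Prop. 5.13 of
the held arXiv text v2) repeatedly pass between a form `f ∈ V_{ℤ_p}` and its perturbations
`f + p g`: "`p² ∣ Δ(f + pg)` for all `g`" (strong divisibility, Thm 2.18), the unique lift in the
proof of Thm 2.20, and, in the proof of Prop. 5.13 / Prop. 3.18, the fact that a form which is
not `ℚ_p`-soluble, or whose stabiliser weight `m_p(f)` is not `1`, has `p² ∣ Δ(f)` — whose
solubility half rests on: *if `p ∥ Δ(f)` then the reduction of `f` has a single double root*
(splitting types `(1²11)`, `(1²2)`), i.e. the reductions with a triple root or of the shape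
`λ q(x,y)²` force `p² ∣ Δ(f)`. This file proves the ring-theoretic identities behind these steps,
over an arbitrary commutative ring `R` and for an arbitrary "modulus" `t ∈ R`:

* exact Taylor expansions `I(f + tg) = I(f) + t·DI(f;g) + t²I(g)` (`I_add_smul`) and
  `J(f + tg) = J(f) + t·DJ(f;g) + t²·DJ(g;f) + t³J(g)` (`J_add_smul`), with the polarisations
  `DI(f;g) = 12(ae' + ea') − 3(bd' + db') + 2cc'`,
  `DJ(f;g) = (72ce − 27d²)a' + (9cd − 54be)b' + (72ae + 9bd − 6c²)c' + (9bc − 54ad)d' + (72ac − 27b²)e'`;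
* hence `27Δ(f + tg) ≡ 27Δ(f) + t·(12I²·DI − 2J·DJ)(f;g) (mod t²)`
  (`sq_dvd_twentySeven_mul_disc_add_smul`): `27·dΔ = 12I²dI − 2JdJ`;
* **triple-root stratum**: `I(l³m) = J(l³m) = 0` for linear forms `l, m` (`I_cubeMul`,
  `J_cubeMul`), so `t² ∣ 27Δ(l³m + tg)` (`sq_dvd_twentySeven_mul_disc_cubeMul_add`);
* **square stratum**: `I(λq²) = λ²D²`, `J(λq²) = −2λ³D³` with `D = disc(q)` (`I_smul_sq`,
  `J_smul_sq`), and **`(12I²·DI − 2J·DJ)(λq²; g) = 0` identically** (`delta_smul_sq`: the square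
  stratum lies in the singular locus of `{Δ = 0}`), so `t² ∣ 27Δ(λq² + tg)`
  (`sq_dvd_twentySeven_mul_disc_smul_sq_add`).

With `t = p` these say: an integral form congruent modulo `p` to a form with a triple root, or to
`λ q²`, has `p² ∣ 27Δ(f)`. The converse direction (a form with `p ∥ Δ` reduces to `l²k`,
`k(l) ≠ 0`, `k` squarefree) and the solubility of such forms are treated in sequel files.

## References

* M. Bhargava, A. Shankar, Ann. of Math. (2) 181 (2015) 191–242, §2.6 (Thms 2.18–2.20) and the
  proof of Prop. 3.18 of the published version; Prop. 5.13 of arXiv:1006.1002v2.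
  [cite: BhargavaShankarAnnals2015, Prop. 5.13, proof (arXiv:1006.1002v2 numbering)]
* The identities are classical invariant theory of the binary quartic (the null cone `I = J = 0`
  and the stratum of squares). [folklore]
-/

noncomputable section

namespace Literature.NumberTheory.EllipticCurves

namespace BinaryQuartic

variable {R : Type*} [CommRing R]

/-! ## Taylor expansions of `I`, `J`, `27Δ` -/

/-- **`I(f + tg) = I(f) + t·DI(f;g) + t²·I(g)`** with `DI(f;g) = 12(ae' + ea') − 3(bd' + db') + 2cc'`
(exact: `I` is quadratic). [folklore] -/
theorem I_add_smul (f g : BinaryQuartic R) (t : R) :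
    (f + t • g).I = f.I
      + t * (12 * (f.a * g.e + f.e * g.a) - 3 * (f.b * g.d + f.d * g.b) + 2 * f.c * g.c)
      + t ^ 2 * g.I := by
  simp only [I, add_a, add_b, add_c, add_d, add_e, smul_a, smul_b, smul_c, smul_d, smul_e]
  ring

/-- **`J(f + tg) = J(f) + t·DJ(f;g) + t²·DJ(g;f) + t³·J(g)`** with
`DJ(f;g) = (72ce − 27d²)a' + (9cd − 54be)b' + (72ae + 9bd − 6c²)c' + (9bc − 54ad)d' + (72ac − 27b²)e'`
(exact: `J` is cubic). [folklore] -/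
theorem J_add_smul (f g : BinaryQuartic R) (t : R) :
    (f + t • g).J = f.J
      + t * ((72 * f.c * f.e - 27 * f.d ^ 2) * g.a + (9 * f.c * f.d - 54 * f.b * f.e) * g.b
          + (72 * f.a * f.e + 9 * f.b * f.d - 6 * f.c ^ 2) * g.c + (9 * f.b * f.c - 54 * f.a * f.d) * g.d
          + (72 * f.a * f.c - 27 * f.b ^ 2) * g.e)
      + t ^ 2 * ((72 * g.c * g.e - 27 * g.d ^ 2) * f.a + (9 * g.c * g.d - 54 * g.b * g.e) * f.b
          + (72 * g.a * g.e + 9 * g.b * g.d - 6 * g.c ^ 2) * f.c + (9 * g.b * g.c - 54 * g.a * g.d) * f.d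
          + (72 * g.a * g.c - 27 * g.b ^ 2) * f.e)
      + t ^ 3 * g.J := by
  simp only [J, add_a, add_b, add_c, add_d, add_e, smul_a, smul_b, smul_c, smul_d, smul_e]
  ring

/-- **`27Δ(f + tg) ≡ 27Δ(f) + t·(12I²·DI − 2J·DJ)(f; g) (mod t²)`**: the differential of
`27Δ = 4I³ − J²`. [folklore] -/
theorem sq_dvd_twentySeven_mul_disc_add_smul (f g : BinaryQuartic R) (t : R) :
    t ^ 2 ∣ 27 * (f + t • g).disc
      - (27 * f.disc + t * (12 * f.I ^ 2
          * (12 * (f.a * g.e + f.e * g.a) - 3 * (f.b * g.d + f.d * g.b) + 2 * f.c * g.c)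
        - 2 * f.J * ((72 * f.c * f.e - 27 * f.d ^ 2) * g.a + (9 * f.c * f.d - 54 * f.b * f.e) * g.b
          + (72 * f.a * f.e + 9 * f.b * f.d - 6 * f.c ^ 2) * g.c + (9 * f.b * f.c - 54 * f.a * f.d) * g.d
          + (72 * f.a * f.c - 27 * f.b ^ 2) * g.e))) := by
  set DI := 12 * (f.a * g.e + f.e * g.a) - 3 * (f.b * g.d + f.d * g.b) + 2 * f.c * g.c with hDI
  set DJ := (72 * f.c * f.e - 27 * f.d ^ 2) * g.a + (9 * f.c * f.d - 54 * f.b * f.e) * g.b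
          + (72 * f.a * f.e + 9 * f.b * f.d - 6 * f.c ^ 2) * g.c + (9 * f.b * f.c - 54 * f.a * f.d) * g.d
          + (72 * f.a * f.c - 27 * f.b ^ 2) * g.e with hDJ
  set DJ' := (72 * g.c * g.e - 27 * g.d ^ 2) * f.a + (9 * g.c * g.d - 54 * g.b * g.e) * f.b
          + (72 * g.a * g.e + 9 * g.b * g.d - 6 * g.c ^ 2) * f.c + (9 * g.b * g.c - 54 * g.a * g.d) * f.d
          + (72 * g.a * g.c - 27 * g.b ^ 2) * f.e with hDJ'
  have hI : (f + t • g).I = f.I + t * DI + t ^ 2 * g.I := by rw [hDI]; exact I_add_smul f g t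
  have hJ : (f + t • g).J = f.J + t * DJ + t ^ 2 * DJ' + t ^ 3 * g.J := by
    rw [hDJ, hDJ']; exact J_add_smul f g t
  refine ⟨12 * f.I * (DI + t * g.I) ^ 2 + 12 * f.I ^ 2 * g.I + 4 * t * (DI + t * g.I) ^ 3
      - (DJ + t * DJ' + t ^ 2 * g.J) ^ 2 - 2 * f.J * (DJ' + t * g.J), ?_⟩
  rw [twentySeven_mul_disc, twentySeven_mul_disc, hI, hJ]
  ring

/-- If `t ∣ I(f)` and `t ∣ J(f)` then `t² ∣ 27Δ(f) = 4I³ − J²`. [folklore] -/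
theorem sq_dvd_twentySeven_mul_disc_of_dvd {f : BinaryQuartic R} {t : R} (hI : t ∣ f.I)
    (hJ : t ∣ f.J) : t ^ 2 ∣ 27 * f.disc := by
  rw [twentySeven_mul_disc]
  obtain ⟨i, hi⟩ := hI
  obtain ⟨j, hj⟩ := hJ
  exact ⟨4 * t * i ^ 3 - j ^ 2, by rw [hi, hj]; ring⟩

/-! ## The triple-root stratum `l³m` (the null cone `I = J = 0`) -/

/-- `I(l³m) = 0` for linear forms `l = l₀x + l₁y`, `m = m₀x + m₁y` (a root of multiplicity `≥ 3`
kills both invariants). [folklore] -/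
theorem I_cubeMul (l₀ l₁ m₀ m₁ : R) :
    (⟨l₀ ^ 3 * m₀, 3 * l₀ ^ 2 * l₁ * m₀ + l₀ ^ 3 * m₁, 3 * l₀ * l₁ ^ 2 * m₀ + 3 * l₀ ^ 2 * l₁ * m₁,
      l₁ ^ 3 * m₀ + 3 * l₀ * l₁ ^ 2 * m₁, l₁ ^ 3 * m₁⟩ : BinaryQuartic R).I = 0 := by
  simp only [I]; ring

/-- `J(l³m) = 0` for linear forms `l`, `m`. [folklore] -/
theorem J_cubeMul (l₀ l₁ m₀ m₁ : R) :
    (⟨l₀ ^ 3 * m₀, 3 * l₀ ^ 2 * l₁ * m₀ + l₀ ^ 3 * m₁, 3 * l₀ * l₁ ^ 2 * m₀ + 3 * l₀ ^ 2 * l₁ * m₁,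
      l₁ ^ 3 * m₀ + 3 * l₀ * l₁ ^ 2 * m₁, l₁ ^ 3 * m₁⟩ : BinaryQuartic R).J = 0 := by
  simp only [J]; ring

/-- `(l³m)(x, y) = l(x,y)³ m(x,y)`: the displayed coefficients are those of `l³m`. [folklore] -/
theorem eval_cubeMul (l₀ l₁ m₀ m₁ x y : R) :
    (⟨l₀ ^ 3 * m₀, 3 * l₀ ^ 2 * l₁ * m₀ + l₀ ^ 3 * m₁, 3 * l₀ * l₁ ^ 2 * m₀ + 3 * l₀ ^ 2 * l₁ * m₁,
      l₁ ^ 3 * m₀ + 3 * l₀ * l₁ ^ 2 * m₁, l₁ ^ 3 * m₁⟩ : BinaryQuartic R).eval x y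
      = (l₀ * x + l₁ * y) ^ 3 * (m₀ * x + m₁ * y) := by
  simp only [eval]; ring

/-- **A form congruent modulo `t` to one with a triple root has `t² ∣ 27Δ`**: both invariants of
`l³m + tg` are divisible by `t`. [cite: BhargavaShankarAnnals2015, Prop. 5.13, proof (arXiv:1006.1002v2 numbering)] -/
theorem sq_dvd_twentySeven_mul_disc_cubeMul_add (l₀ l₁ m₀ m₁ t : R) (g : BinaryQuartic R) :
    t ^ 2 ∣ 27 * ((⟨l₀ ^ 3 * m₀, 3 * l₀ ^ 2 * l₁ * m₀ + l₀ ^ 3 * m₁,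
        3 * l₀ * l₁ ^ 2 * m₀ + 3 * l₀ ^ 2 * l₁ * m₁, l₁ ^ 3 * m₀ + 3 * l₀ * l₁ ^ 2 * m₁,
        l₁ ^ 3 * m₁⟩ : BinaryQuartic R) + t • g).disc := by
  apply sq_dvd_twentySeven_mul_disc_of_dvd
  · rw [I_add_smul, I_cubeMul, zero_add]
    exact dvd_add (dvd_mul_right t _) ((dvd_pow_self t two_ne_zero).mul_right _)
  · rw [J_add_smul, J_cubeMul, zero_add]
    exact dvd_add (dvd_add (dvd_mul_right t _) ((dvd_pow_self t two_ne_zero).mul_right _))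
      ((dvd_pow_self t three_ne_zero).mul_right _)

/-! ## The square stratum `λ q²` -/

/-- `(λq²)(x, y) = λ q(x,y)²` for `q = q₀x² + q₁xy + q₂y²`: the displayed coefficients are those of
`λq²`. [folklore] -/
theorem eval_smul_sq (lam q₀ q₁ q₂ x y : R) :
    (lam • (⟨q₀ ^ 2, 2 * q₀ * q₁, q₁ ^ 2 + 2 * q₀ * q₂, 2 * q₁ * q₂, q₂ ^ 2⟩ : BinaryQuartic R)).eval x y
      = lam * (q₀ * x ^ 2 + q₁ * x * y + q₂ * y ^ 2) ^ 2 := by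
  rw [eval_smul]; simp only [eval]; ring

/-- `I(λq²) = λ²·disc(q)²`, `disc(q) = q₁² − 4q₀q₂`. [folklore] -/
theorem I_smul_sq (lam q₀ q₁ q₂ : R) :
    (lam • (⟨q₀ ^ 2, 2 * q₀ * q₁, q₁ ^ 2 + 2 * q₀ * q₂, 2 * q₁ * q₂, q₂ ^ 2⟩ : BinaryQuartic R)).I
      = lam ^ 2 * (q₁ ^ 2 - 4 * q₀ * q₂) ^ 2 := by
  rw [I_smul]; simp only [I]; ring

/-- `J(λq²) = −2λ³·disc(q)³`. [folklore] -/
theorem J_smul_sq (lam q₀ q₁ q₂ : R) :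
    (lam • (⟨q₀ ^ 2, 2 * q₀ * q₁, q₁ ^ 2 + 2 * q₀ * q₂, 2 * q₁ * q₂, q₂ ^ 2⟩ : BinaryQuartic R)).J
      = -2 * lam ^ 3 * (q₁ ^ 2 - 4 * q₀ * q₂) ^ 3 := by
  rw [J_smul]; simp only [J]; ring

/-- `Δ(λq²) = 0` (through `27Δ = 4I³ − J²`): `27Δ(λq²) = 0`. [folklore] -/
theorem twentySeven_mul_disc_smul_sq (lam q₀ q₁ q₂ : R) :
    27 * (lam • (⟨q₀ ^ 2, 2 * q₀ * q₁, q₁ ^ 2 + 2 * q₀ * q₂, 2 * q₁ * q₂, q₂ ^ 2⟩ :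
      BinaryQuartic R)).disc = 0 := by
  rw [twentySeven_mul_disc, I_smul_sq, J_smul_sq]; ring

/-- **The square stratum is singular for `Δ`: `(12I²·DI − 2J·DJ)(λq²; g) = 0` for every
direction `g`** (with `f = λq²` written out on coefficients). [folklore] -/
theorem delta_smul_sq (lam q₀ q₁ q₂ : R) (g : BinaryQuartic R) :
    12 * (lam • (⟨q₀ ^ 2, 2 * q₀ * q₁, q₁ ^ 2 + 2 * q₀ * q₂, 2 * q₁ * q₂, q₂ ^ 2⟩ :
          BinaryQuartic R)).I ^ 2
        * (12 * (lam * q₀ ^ 2 * g.e + lam * q₂ ^ 2 * g.a)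
            - 3 * (lam * (2 * q₀ * q₁) * g.d + lam * (2 * q₁ * q₂) * g.b)
            + 2 * (lam * (q₁ ^ 2 + 2 * q₀ * q₂)) * g.c)
      - 2 * (lam • (⟨q₀ ^ 2, 2 * q₀ * q₁, q₁ ^ 2 + 2 * q₀ * q₂, 2 * q₁ * q₂, q₂ ^ 2⟩ :
          BinaryQuartic R)).J
        * ((72 * (lam * (q₁ ^ 2 + 2 * q₀ * q₂)) * (lam * q₂ ^ 2) - 27 * (lam * (2 * q₁ * q₂)) ^ 2) * g.a
          + (9 * (lam * (q₁ ^ 2 + 2 * q₀ * q₂)) * (lam * (2 * q₁ * q₂))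
              - 54 * (lam * (2 * q₀ * q₁)) * (lam * q₂ ^ 2)) * g.b
          + (72 * (lam * q₀ ^ 2) * (lam * q₂ ^ 2) + 9 * (lam * (2 * q₀ * q₁)) * (lam * (2 * q₁ * q₂))
              - 6 * (lam * (q₁ ^ 2 + 2 * q₀ * q₂)) ^ 2) * g.c
          + (9 * (lam * (2 * q₀ * q₁)) * (lam * (q₁ ^ 2 + 2 * q₀ * q₂))
              - 54 * (lam * q₀ ^ 2) * (lam * (2 * q₁ * q₂))) * g.d
          + (72 * (lam * q₀ ^ 2) * (lam * (q₁ ^ 2 + 2 * q₀ * q₂)) - 27 * (lam * (2 * q₀ * q₁)) ^ 2) * g.e)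
      = 0 := by
  rw [I_smul_sq, J_smul_sq]
  ring

/-- **A form congruent modulo `t` to `λq²` has `t² ∣ 27Δ`.** [cite: BhargavaShankarAnnals2015, Prop. 5.13, proof (arXiv:1006.1002v2 numbering)] -/
theorem sq_dvd_twentySeven_mul_disc_smul_sq_add (lam q₀ q₁ q₂ t : R) (g : BinaryQuartic R) :
    t ^ 2 ∣ 27 * (lam • (⟨q₀ ^ 2, 2 * q₀ * q₁, q₁ ^ 2 + 2 * q₀ * q₂, 2 * q₁ * q₂, q₂ ^ 2⟩ :
      BinaryQuartic R) + t • g).disc := by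
  have h := sq_dvd_twentySeven_mul_disc_add_smul
    (lam • (⟨q₀ ^ 2, 2 * q₀ * q₁, q₁ ^ 2 + 2 * q₀ * q₂, 2 * q₁ * q₂, q₂ ^ 2⟩ : BinaryQuartic R)) g t
  have hδ := delta_smul_sq lam q₀ q₁ q₂ g
  simp only [smul_a, smul_b, smul_c, smul_d, smul_e] at h
  rw [hδ, mul_zero, add_zero, twentySeven_mul_disc_smul_sq, sub_zero] at h
  exact h

/-- The same with the perturbation written as a congruence: if every coefficient of `f − λq²` is
divisible by `t`, then `t² ∣ 27Δ(f)`. [cite: BhargavaShankarAnnals2015, Prop. 5.13, proof (arXiv:1006.1002v2 numbering)] -/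
theorem sq_dvd_twentySeven_mul_disc_of_congr_smul_sq (lam q₀ q₁ q₂ t : R) (f : BinaryQuartic R)
    (ha : t ∣ f.a - lam * q₀ ^ 2) (hb : t ∣ f.b - lam * (2 * q₀ * q₁))
    (hc : t ∣ f.c - lam * (q₁ ^ 2 + 2 * q₀ * q₂)) (hd : t ∣ f.d - lam * (2 * q₁ * q₂))
    (he : t ∣ f.e - lam * q₂ ^ 2) : t ^ 2 ∣ 27 * f.disc := by
  obtain ⟨a', ha'⟩ := ha
  obtain ⟨b', hb'⟩ := hb
  obtain ⟨c', hc'⟩ := hc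
  obtain ⟨d', hd'⟩ := hd
  obtain ⟨e', he'⟩ := he
  have hf : f = lam • (⟨q₀ ^ 2, 2 * q₀ * q₁, q₁ ^ 2 + 2 * q₀ * q₂, 2 * q₁ * q₂, q₂ ^ 2⟩ :
      BinaryQuartic R) + t • (⟨a', b', c', d', e'⟩ : BinaryQuartic R) := by
    ext <;> simp only [add_a, add_b, add_c, add_d, add_e, smul_a, smul_b, smul_c, smul_d, smul_e]
    · linear_combination ha'
    · linear_combination hb'
    · linear_combination hc'
    · linear_combination hd'
    · linear_combination he'
  rw [hf]
  exact sq_dvd_twentySeven_mul_disc_smul_sq_add lam q₀ q₁ q₂ t _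

/-- Triple-root version as a congruence: if every coefficient of `f − l³m` is divisible by `t`,
then `t² ∣ 27Δ(f)`. [cite: BhargavaShankarAnnals2015, Prop. 5.13, proof (arXiv:1006.1002v2 numbering)] -/
theorem sq_dvd_twentySeven_mul_disc_of_congr_cubeMul (l₀ l₁ m₀ m₁ t : R) (f : BinaryQuartic R)
    (ha : t ∣ f.a - l₀ ^ 3 * m₀) (hb : t ∣ f.b - (3 * l₀ ^ 2 * l₁ * m₀ + l₀ ^ 3 * m₁))
    (hc : t ∣ f.c - (3 * l₀ * l₁ ^ 2 * m₀ + 3 * l₀ ^ 2 * l₁ * m₁))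
    (hd : t ∣ f.d - (l₁ ^ 3 * m₀ + 3 * l₀ * l₁ ^ 2 * m₁)) (he : t ∣ f.e - l₁ ^ 3 * m₁) :
    t ^ 2 ∣ 27 * f.disc := by
  obtain ⟨a', ha'⟩ := ha
  obtain ⟨b', hb'⟩ := hb
  obtain ⟨c', hc'⟩ := hc
  obtain ⟨d', hd'⟩ := hd
  obtain ⟨e', he'⟩ := he
  have hf : f = (⟨l₀ ^ 3 * m₀, 3 * l₀ ^ 2 * l₁ * m₀ + l₀ ^ 3 * m₁,
        3 * l₀ * l₁ ^ 2 * m₀ + 3 * l₀ ^ 2 * l₁ * m₁, l₁ ^ 3 * m₀ + 3 * l₀ * l₁ ^ 2 * m₁,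
        l₁ ^ 3 * m₁⟩ : BinaryQuartic R) + t • (⟨a', b', c', d', e'⟩ : BinaryQuartic R) := by
    ext <;> simp only [add_a, add_b, add_c, add_d, add_e, smul_a, smul_b, smul_c, smul_d, smul_e]
    · linear_combination ha'
    · linear_combination hb'
    · linear_combination hc'
    · linear_combination hd'
    · linear_combination he'
  rw [hf]
  exact sq_dvd_twentySeven_mul_disc_cubeMul_add l₀ l₁ m₀ m₁ t _

end BinaryQuartic

end Literature.NumberTheory.EllipticCurves

end
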